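import Literature.MathematicalPhysics.QuantumFieldTheory.Balaban1983to89.B11Eq117LetterDefects
import Literature.MathematicalPhysics.QuantumFieldTheory.Balaban1983to89.B11Eq120SolutionContinuity
import Literature.MathematicalPhysics.QuantumFieldTheory.Balaban1983to89.B11Eq44COperatorTorus

/-!
# `Balaban1983to89.B11Eq174ChartContinuityAtFlat` — T. Bałaban, *The variational problem and background fields in renormalization group method for
# lattice gauge theories*, Commun. Math. Phys. **102** (1985) 277–309 [Balaban1985Variational] Prop. 6 (116)–(121) p. 295, (174)–(175) p. 305, Prop. 9
# p. 309, with [Balaban1985BackgroundPropagators] Thm 3.4 p. 400: THE CONFIGURATION `𝒜_U(H₁(U)B) + H₁(U)B` OF THE CHART (174) AT THE NE9 CHAIN'S LETTERS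
# IS LIPSCHITZ IN THE BACKGROUND AT THE FLAT POINT, AT A FIXED LATTICE — read from `Space115 … (∇_U)` into `Space115 … (∇_1)` through the jet identity:
# `‖ι(𝒜_U + H₁(U)B) − (𝒜_1 + H₁(1)B)‖ ≤ (K_G ε (j + C₄(ε₄+a)²) + B₀′δ_W + K_A ε‖B‖)∕(1 − κ₂)` modulo the (L3) slot's own modulus `δ_W`

statement-level skeleton of published theorems with citation tags; proofs where landed; nothing here is a claim about the Yang–Mills mass gap

PDF held: `paper:balaban1985-cmp102-variational-background` (journal page = PDF page + 276): p. 295 Prop. 6 (*«Eq. (111) has exactly one solution in the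
space (115) … the solution is an analytic function of 𝔄»*), p. 305 (174)–(175), p. 309 Prop. 9 (*«The function 𝓗(B) is determined by Eqs. (174), (175)
… It is an analytic function of B»*); `paper:balaban1985-cmp99-background-propagators` p. 400 Thm 3.4 (the Green's functions as *«analytic functions of A»*
of the background `U′U`, `U′ = e^{iηA}`, convergent *«in the operator norm»*).  Print proves analyticity in `𝔄`/`B` at a fixed background and analyticity
of the LETTERS in the background; the continuity of the chart's configuration in the background is the cell's fixed-lattice composition of the two.

WHY THIS FILE (cell context).  Item (ii) of the NE9 owner lineage's g81 list «CONTINUITY OF THE CHART ITSELF in `U`»: the chart of the curve species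
`cur U` is `chartHB 𝔊(U) 0 W 0 T(U) ε₄ H₁(U)` (`Support/NE9CurChartUniformBall`), valued in `Space115 … (∇_U)`.  `B11Eq120SolutionContinuity` (gen 82)
compares solutions across two carriers through a bounded `ι` given the defects `K_ι, δ_G, δ_Λ, δ_W, δ_A`; `B11Eq117LetterDefects` (gen 82) PRODUCES
`K_ι, δ_G, δ_A` at the chain's letters at every small field.  This file composes them for the `Λ := 0`, `J := 0` face: only the (L3) slot's modulus `δ_W`
(the background dependence of `W = (δ/δA′)V`, NE9 leaf-05's `W80`) and the scalar regime letters stay displayed.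

WHAT IS PROVED (sorry-free; composition; 0 def; no inequality of the paper asserted).
* **`exists_chart_arg_lipschitz_at_flat`** — `∃ K_G K_A K_ι ε₉ > 0 ∀ U` (E162 data, `‖U(b) − 1‖ ≤ ε ≤ ε₉`, `hRS`) `∀ hpos hQ hpos₁ hQ₁`, for ALL (L3)
  slots `W_U : Space115(∇_U) → |·|_(−3)`, `W_1 : Space115(∇_1) → |·|_(−3)`, regimes `R_U = (𝔊(U), 0, W_U; B₀, θ, C₄, a₃, j, a, ε₄)`,
  `R_1 = (𝔊(1), 0, W_1; B₀′, θ′, C₄′, a₃′, j′, a′, ε₄′)` (`j, j′ ≥ 0`), block fields `B` with `‖H₁(U)B‖ < a`, `‖H₁(1)B‖ < a′`, a modulus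
  `‖W_U P − W_1(ιP)‖ ≤ δ_W` on `‖P‖ < ε₄ + a`, and radii `(1 + K_ι ε)(ε₄ + a) ≤ ρ`, `ε₄′ + a′ ≤ ρ`, `s > 0`, `2(ρ + s) ≤ a₃′`,
  `κ₂ := θ′ + 4B₀′C₄′(ρ + s) < 1`:
  `‖ι(𝒜_U(H₁(U)B) + H₁(U)B) − (𝒜_1(H₁(1)B) + H₁(1)B)‖_(115),∇_1 ≤ (K_G·ε·(j + C₄(ε₄ + a)²) + B₀′δ_W + K_A·ε·‖B‖)∕(1 − κ₂)`
  (`𝒜 = solA … 0 W 0 ε₄ (H₁B)`, `ι` the jet identity `∇_U → ∇_1`) — `B11Eq120SolutionContinuity.norm_map_arg_sub_arg_le` at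
  `K_ι := 1 + K_ι⁰ε` (`norm_jetId_nabla_le`), `δ_G := K_Gε`, `δ_A := K_Aε‖B‖` (`exists_letter_defects_at_flat`), `δ_Λ := 0`.
* **`exists_chartHB_lipschitz_at_flat`** — the FULL chart (174)∘(47) with the Sect. C T-slot `A′ ↦ A′ + solA H₁(U) 0 C(U) 0 ε_C A′`:
  `‖ι(chartHB_U B) − chartHB_1 B‖ ≤ (…)∕((1 − κ₂)(1 − κ_C)) + (K_A ε C₂(ε_C + a_C)² + b′δ_C)∕(1 − κ_C)`, the `C(U)`-letter's modulus `δ_C` and the Sect. C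
  regimes DISPLAYED (`B11Eq120SolutionContinuity.norm_map_chartHB_sectC_sub_le`, v1.1).
MODEL / HONEST SCOPE.  The one-level periodic model of `B9Eq315QTorus`; every constant is a finite-lattice number; first order AT THE FLAT POINT only
(not between two general small fields); the moduli `δ_W` of the (L3) slot and `δ_C` of the Sect. C letter `C(U)` = `B11Eq44COperatorTorus.Cc` are
DISPLAYED ([Balaban1985Averaging] Prop. 7 would give `δ_C = O(ε)`; not in the tree as a modulus); NOT print's uniformity in the lattice, NOT analyticity in `A`; NOT summit progress (cell pub-balaban: NE9 NOT PRINTED / NOT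
PROVED; spine PROVED 0/9).  Filed by the pub-balaban NE9 BINDER-row owner lineage `b2b-balaban-t4-ne9-p1` (gen 82); NEW file importing
`B11Eq117LetterDefects`, `B11Eq120SolutionContinuity` (v1.1), `B11Eq44COperatorTorus` only; nothing modified.  Net new unproved facts: 0.
-/

noncomputable section

namespace Literature.MathematicalPhysics.QuantumFieldTheory.Balaban1983to89.B11Eq174ChartContinuityAtFlat

open scoped InnerProductSpace
open Metric Set
open B11Eq115Space B11Eq111FrakG B11Eq103H1Complex
open B13Contraction113 (QuadAnalytic)
open B11Eq174Chart (Regime solA)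
open B9SectCLatticeCarrier (Bond)
open B4Sect5Torus (TSite)
open B7Prop1Explicit (U1 Wcx boxVec)
open B9Eq319QprimeTorus (fineP)
open B9Eq310HessianOperator (adTransportW hessOp)
open B9Eq315QTorus (perCfg cornerSite QtorusW laplaceAofBackground)
open B9Eq315QTorusOnto (liftSite perSite_liftSite)
open B5Eq172FlatCoercivity (hU1_one hreg_one)
open B11Eq117LetterDefects (norm_jetId_nabla_le exists_letter_defects_at_flat)
open B11Eq120SolutionContinuity (norm_map_arg_sub_arg_le norm_map_chartHB_sectC_sub_le)
open B11Eq44COperatorTorus (Cc)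
open B11Eq174Chart (chartHB)

variable {d : ℕ} (L : ℕ) [NeZero L] (m : Fin d → ℕ) [∀ i, NeZero (fineP L m i)] (hL : 1 ≤ L)
  {𝔸 : Type*} [NormedRing 𝔸] [NormedAlgebra ℂ 𝔸] [CompleteSpace 𝔸] [NormOneClass 𝔸] [StarRing 𝔸] [NormedStarGroup 𝔸] [StarModule ℂ 𝔸]
  [FiniteDimensional ℂ 𝔸]
  {W : Type*} [NormedAddCommGroup W] [InnerProductSpace ℂ W] [FiniteDimensional ℂ W] (φ : W ≃ₗ[ℂ] 𝔸) {c₀ c₁ : ℝ} [Fact (0 < c₀)] [Fact (0 < c₁)]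

set_option maxHeartbeats 800000 in
set_option maxRecDepth 8192 in
/-- **THE CONFIGURATION OF THE CHART (174) AT THE CHAIN'S LETTERS IS LIPSCHITZ IN THE BACKGROUND AT THE FLAT POINT (fixed lattice, `Λ := 0`,
`J := 0` face)** — see the module header for the letters: `‖ι(𝒜_U(H₁(U)B) + H₁(U)B) − (𝒜_1(H₁(1)B) + H₁(1)B)‖_(115),∇_1 ≤
(K_G·ε·(j + C₄(ε₄ + a)²) + B₀′δ_W + K_A·ε·‖B‖)∕(1 − κ₂)`, the defects `K_ι = 1 + K_ι⁰ε`, `δ_G = K_Gε`, `δ_A = K_Aε‖B‖` PRODUCED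
(`B11Eq117LetterDefects`), the W-slot modulus `δ_W` and the scalar regime letters DISPLAYED; composition by `B11Eq120SolutionContinuity.norm_map_arg_sub_arg_le`.
[cite: Balaban1985Variational, Prop. 6 (116)–(121) p.295, (174)–(175) p.305, Prop. 9 p.309; Balaban1985BackgroundPropagators, Thm 3.4 p.400, (3.86) p.407] -/
theorem exists_chart_arg_lipschitz_at_flat {η : ℝ} [Fact (0 < (L : ℝ))] [Fact (0 < η)] (lev₀ : Bond d (fineP L m) → ℕ) (levB : Bond d m → ℕ)
    (lev₁ : Bond d (fineP L m) × Fin d → ℕ) {a₀ : ℝ} (ha₀ : 0 < a₀) {Mφ Mφ' : ℝ} (hMφ : 0 ≤ Mφ) (hMφ' : 0 ≤ Mφ')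
    (hφ : ∀ w, ‖φ w‖ ≤ Mφ * ‖w‖) (hφ' : ∀ X, ‖φ.symm X‖ ≤ Mφ' * ‖X‖) (τ : 𝔸 →ₗ[ℂ] ℂ) {Cτ : ℝ} (hτ : ∀ X, ‖τ X‖ ≤ Cτ * ‖X‖) (hCτ : 0 ≤ Cτ) :
    ∃ KG KA Kι ε₉ : ℝ, 0 < KG ∧ 0 < KA ∧ 0 < Kι ∧ 0 < ε₉ ∧ ∀ (U : Bond d (fineP L m) → 𝔸ˣ) {α : ℝ} (hα1 : α ≤ 1 / 64)
      (hU1 : ∀ (x : B7Prop1Explicit.Site d) (κ : Fin d), perCfg (fineP L m) U x κ ∈ U1 𝔸)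
      (hreg : ∀ (y : TSite d m) (κ : Fin d) (r : Fin d → Fin L), ‖((Wcx L (perCfg (fineP L m) U) (cornerSite L y) κ (boxVec L r) : 𝔸ˣ) : 𝔸) - 1‖ ≤ α)
      {ε : ℝ}, 0 ≤ ε → ε ≤ ε₉ → (∀ b, ‖(U b : 𝔸) - 1‖ ≤ ε) →
      (∀ (b : Bond d (fineP L m)) (v u : W), ⟪adTransportW φ U b v, u⟫_ℂ = ⟪v, adTransportW φ (fun b => (U b)⁻¹) b u⟫_ℂ) →
      ∀ (hpos : ∀ x : BondL2K ℂ d (fineP L m) c₀ W, x ≠ 0 →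
          0 < RCLike.re ⟪x, laplaceAofBackground L m hL φ U hα1 hU1 hreg τ η (c₀ := c₀) (c₁ := c₁) a₀ x⟫_ℂ)
        (hQ : Function.Surjective (QtorusW L m hL φ U hα1 hU1 hreg (c₀ := c₀) (c₁ := c₁)))
        (hpos₁ : ∀ x : BondL2K ℂ d (fineP L m) c₀ W, x ≠ 0 →
          0 < RCLike.re ⟪x, laplaceAofBackground L m hL φ (fun _ => 1) (show (0 : ℝ) ≤ 1 / 64 by norm_num) (hU1_one L m) (hreg_one L m) τ η
            (c₀ := c₀) (c₁ := c₁) a₀ x⟫_ℂ)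
        (hQ₁ : Function.Surjective (QtorusW L m hL φ (fun _ => 1) (show (0 : ℝ) ≤ 1 / 64 by norm_num) (hU1_one L m) (hreg_one L m)
          (c₀ := c₀) (c₁ := c₁)))
        {W₁ : Space115 (L : ℝ) η lev₀ lev₁ (nabla115 η U) → NegSize (L : ℝ) η lev₀ 3 𝔸}
        {W₂ : Space115 (L : ℝ) η lev₀ lev₁ (nabla115 η fun _ : Bond d (fineP L m) => (1 : 𝔸ˣ)) → NegSize (L : ℝ) η lev₀ 3 𝔸}
        {B₀ θ C₄ a₃ j a ε₄ B₀' θ' C₄' a₃' j' a' ε₄' δW ρ s : ℝ}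
        (_R₁ : Regime (frakGLatticeCLM (L := (L : ℝ)) (η := η) (lev₀ := lev₀) φ hpos hQ lev₁ (nabla115 η U)) 0 W₁ B₀ θ C₄ a₃ j a ε₄)
        (_R₂ : Regime (frakGLatticeCLM (L := (L : ℝ)) (η := η) (lev₀ := lev₀) (Δ₁ := hessOp φ η (fun _ => 1) τ)
          (Q := QtorusW L m hL φ (fun _ => 1) (show (0 : ℝ) ≤ 1 / 64 by norm_num) (hU1_one L m) (hreg_one L m) (c₀ := c₀) (c₁ := c₁))
          φ hpos₁ hQ₁ lev₁ (nabla115 η fun _ => 1)) 0 W₂ B₀' θ' C₄' a₃' j' a' ε₄')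
        (_hj : 0 ≤ j) (_hj' : 0 ≤ j') (B : NegSize (L : ℝ) η levB 0 𝔸)
        (_hB : ‖H1LatticeCLM (L := (L : ℝ)) (η := η) (lev₀ := lev₀) (levB := levB) φ hpos hQ lev₁ (nabla115 η U) B‖ < a)
        (_hB' : ‖H1LatticeCLM (L := (L : ℝ)) (η := η) (lev₀ := lev₀) (levB := levB) (Δ₁ := hessOp φ η (fun _ => 1) τ)
          (Q := QtorusW L m hL φ (fun _ => 1) (show (0 : ℝ) ≤ 1 / 64 by norm_num) (hU1_one L m) (hreg_one L m) (c₀ := c₀) (c₁ := c₁))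
          φ hpos₁ hQ₁ lev₁ (nabla115 η fun _ => 1) B‖ < a')
        (_hδW : ∀ P : Space115 (L : ℝ) η lev₀ lev₁ (nabla115 η U), ‖P‖ < ε₄ + a →
          ‖W₁ P - W₂ (LinearMap.toContinuousLinearMap
            ((jetLinearEquiv (L : ℝ) η lev₀ lev₁ (nabla115 η (fun _ : Bond d (fineP L m) => (1 : 𝔸ˣ)))).symm.toLinearMap ∘ₗ
              (jetLinearEquiv (L : ℝ) η lev₀ lev₁ (nabla115 η U)).toLinearMap) P)‖ ≤ δW)
        (_hρ₁ : (1 + Kι * ε) * (ε₄ + a) ≤ ρ) (_hρ₂ : ε₄' + a' ≤ ρ) (_hs : 0 < s) (_hdom : 2 * (ρ + s) ≤ a₃')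
        (_hκ : θ' + 4 * B₀' * C₄' * (ρ + s) < 1),
      ‖LinearMap.toContinuousLinearMap
            ((jetLinearEquiv (L : ℝ) η lev₀ lev₁ (nabla115 η (fun _ : Bond d (fineP L m) => (1 : 𝔸ˣ)))).symm.toLinearMap ∘ₗ
              (jetLinearEquiv (L : ℝ) η lev₀ lev₁ (nabla115 η U)).toLinearMap)
          (solA (frakGLatticeCLM (L := (L : ℝ)) (η := η) (lev₀ := lev₀) φ hpos hQ lev₁ (nabla115 η U)) 0 W₁ 0 ε₄
              (H1LatticeCLM (L := (L : ℝ)) (η := η) (lev₀ := lev₀) (levB := levB) φ hpos hQ lev₁ (nabla115 η U) B) +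
            H1LatticeCLM (L := (L : ℝ)) (η := η) (lev₀ := lev₀) (levB := levB) φ hpos hQ lev₁ (nabla115 η U) B) -
        (solA (frakGLatticeCLM (L := (L : ℝ)) (η := η) (lev₀ := lev₀) (Δ₁ := hessOp φ η (fun _ => 1) τ)
              (Q := QtorusW L m hL φ (fun _ => 1) (show (0 : ℝ) ≤ 1 / 64 by norm_num) (hU1_one L m) (hreg_one L m) (c₀ := c₀) (c₁ := c₁))
              φ hpos₁ hQ₁ lev₁ (nabla115 η fun _ => 1)) 0 W₂ 0 ε₄'
            (H1LatticeCLM (L := (L : ℝ)) (η := η) (lev₀ := lev₀) (levB := levB) (Δ₁ := hessOp φ η (fun _ => 1) τ)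
              (Q := QtorusW L m hL φ (fun _ => 1) (show (0 : ℝ) ≤ 1 / 64 by norm_num) (hU1_one L m) (hreg_one L m) (c₀ := c₀) (c₁ := c₁))
              φ hpos₁ hQ₁ lev₁ (nabla115 η fun _ => 1) B) +
          H1LatticeCLM (L := (L : ℝ)) (η := η) (lev₀ := lev₀) (levB := levB) (Δ₁ := hessOp φ η (fun _ => 1) τ)
            (Q := QtorusW L m hL φ (fun _ => 1) (show (0 : ℝ) ≤ 1 / 64 by norm_num) (hU1_one L m) (hreg_one L m) (c₀ := c₀) (c₁ := c₁))
            φ hpos₁ hQ₁ lev₁ (nabla115 η fun _ => 1) B)‖ ≤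
        (KG * ε * (j + C₄ * (ε₄ + a) ^ 2) + B₀' * δW + KA * ε * ‖B‖) / (1 - (θ' + 4 * B₀' * C₄' * (ρ + s))) := by
  obtain ⟨KG, KA, ε₉, hKG, hKA, hε₉, H⟩ :=
    exists_letter_defects_at_flat L m hL φ (c₀ := c₀) (c₁ := c₁) (η := η) lev₀ levB lev₁ ha₀ hMφ hMφ' hφ hφ' τ hτ hCτ
  -- the slope of the jet identity's bound: `‖ι‖ ≤ 1 + Kι·ε`
  obtain ⟨Kι, hKιdef⟩ : ∃ Kι : ℝ, Kι = (NegSup.wSup (levWeight (L : ℝ) η lev₁ 2) : ℝ) * (2 * ‖((η : ℂ))⁻¹‖) *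
      NegSup.wInvSup (levWeight (L : ℝ) η lev₀ 1) + 1 := ⟨_, rfl⟩
  have hKι : 0 < Kι := by rw [hKιdef]; positivity
  refine ⟨KG, KA, Kι, ε₉, hKG, hKA, hKι, hε₉, ?_⟩
  intro U α hα1 hU1 hreg ε hε hεε₉ hUε hRS hpos hQ hpos₁ hQ₁ W₁ W₂ B₀ θ C₄ a₃ j a ε₄ B₀' θ' C₄' a₃' j' a' ε₄' δW ρ s R₁ R₂ hj hj' B hB hB'
    hδW hρ₁ hρ₂ hs hdom hκ
  obtain ⟨HG, HA⟩ := H U hα1 hU1 hreg hε hεε₉ hUε hRS hpos hQ hpos₁ hQ₁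
  -- `U(b) ∈ U1` read off E162's `hU1`
  have hUb : ∀ b : Bond d (fineP L m), U b ∈ U1 𝔸 := fun b => by
    obtain ⟨y, κ⟩ := b
    have h := hU1 (liftSite y) κ
    rwa [B9Eq315QTorus.perCfg_apply, perSite_liftSite] at h
  -- the comparison map's bound `‖ι f‖ ≤ (1 + Kι ε)‖f‖`
  have hι : ∀ f : Space115 (L : ℝ) η lev₀ lev₁ (nabla115 η U),
      ‖LinearMap.toContinuousLinearMap
          ((jetLinearEquiv (L : ℝ) η lev₀ lev₁ (nabla115 η (fun _ : Bond d (fineP L m) => (1 : 𝔸ˣ)))).symm.toLinearMap ∘ₗ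
            (jetLinearEquiv (L : ℝ) η lev₀ lev₁ (nabla115 η U)).toLinearMap) f‖ ≤ (1 + Kι * ε) * ‖f‖ := fun f => by
    refine (norm_jetId_nabla_le L m (η := η) (lev₀ := lev₀) lev₁ U hUb hε hUε f).trans (mul_le_mul_of_nonneg_right ?_ (norm_nonneg f))
    rw [hKιdef]
    have h0 : 0 ≤ (NegSup.wSup (levWeight (L : ℝ) η lev₁ 2) : ℝ) * (2 * ‖((η : ℂ))⁻¹‖ * ε) * NegSup.wInvSup (levWeight (L : ℝ) η lev₀ 1) := by
      positivity
    nlinarith [h0, hε]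
  have hJ : ‖(0 : NegSize (L : ℝ) η lev₀ 3 𝔸)‖ ≤ j := by rw [norm_zero]; exact hj
  have hJ' : ‖(0 : NegSize (L : ℝ) η lev₀ 3 𝔸)‖ ≤ j' := by rw [norm_zero]; exact hj'
  have hδΛ : ∀ y : Space115 (L : ℝ) η lev₀ lev₁ (nabla115 η U),
      ‖LinearMap.toContinuousLinearMap
          ((jetLinearEquiv (L : ℝ) η lev₀ lev₁ (nabla115 η (fun _ : Bond d (fineP L m) => (1 : 𝔸ˣ)))).symm.toLinearMap ∘ₗ
            (jetLinearEquiv (L : ℝ) η lev₀ lev₁ (nabla115 η U)).toLinearMap) ((0 : _ →L[ℂ] _) y) -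
        (0 : _ →L[ℂ] _) (LinearMap.toContinuousLinearMap
          ((jetLinearEquiv (L : ℝ) η lev₀ lev₁ (nabla115 η (fun _ : Bond d (fineP L m) => (1 : 𝔸ˣ)))).symm.toLinearMap ∘ₗ
            (jetLinearEquiv (L : ℝ) η lev₀ lev₁ (nabla115 η U)).toLinearMap) y)‖ ≤ 0 * ‖y‖ := fun y => by simp
  have h := norm_map_arg_sub_arg_le (J := (0 : NegSize (L : ℝ) η lev₀ 3 𝔸)) R₁ R₂ hJ hJ' hB hB' (by positivity) hι (by positivity) le_rfl
    HG hδΛ hδW (HA B) hρ₁ hρ₂ hs hdom hκ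
  refine h.trans (le_of_eq ?_)
  congr 1
  ring


set_option maxHeartbeats 800000 in
set_option maxRecDepth 8192 in
/-- **THE FULL CHART (174)∘(47) OF `cur U` AT THE CHAIN'S LETTERS IS LIPSCHITZ IN THE BACKGROUND AT THE FLAT POINT (fixed lattice)** — the
species' `chartHB 𝔊(U) 0 W 0 (A′ ↦ A′ + solA H₁(U) 0 C(U) 0 ε_C A′) ε₄ H₁(U)` read into the flat (115) norm against the flat chart:
`‖ι(chartHB_U B) − chartHB_1 B‖ ≤ (K_G·ε·(j + C₄(ε₄+a)²) + B₀′δ_W + K_A·ε·‖B‖)∕((1 − κ₂)(1 − κ_C)) + (K_A·ε·C₂(ε_C + a_C)² + b′δ_C)∕(1 − κ_C)`,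
the letter defects `K_ι, δ_G, δ_A = δ_H` PRODUCED (`B11Eq117LetterDefects`; the Sect. C letter `H` of the chain is the same `H₁(U)` = (3.126), face
`cur_chart_exists_of_W_H126`), the (L3) slot's modulus `δ_W`, the `C(U)`-letter's modulus `δ_C` (`B11Eq44COperatorTorus.Cc`: [Balaban1985Averaging] Prop. 7's
background-analyticity of the one-step map would give `δ_C = O(ε)` — not in the tree as a modulus yet) and the four regimes' scalar letters DISPLAYED;
composition by `B11Eq120SolutionContinuity.norm_map_chartHB_sectC_sub_le` (v1.1).
[cite: Balaban1985Variational, (174)–(175) p.305, (47)–(50) p.285, Prop. 6 (116)–(121) p.295, Prop. 9 p.309; Balaban1985BackgroundPropagators, Thm 3.4 p.400; Balaban1985Averaging, Prop. 7 p.43] -/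
theorem exists_chartHB_lipschitz_at_flat {η : ℝ} [Fact (0 < (L : ℝ))] [Fact (0 < η)] (lev₀ : Bond d (fineP L m) → ℕ) (levB : Bond d m → ℕ)
    (lev₁ : Bond d (fineP L m) × Fin d → ℕ) {a₀ : ℝ} (ha₀ : 0 < a₀) {Mφ Mφ' : ℝ} (hMφ : 0 ≤ Mφ) (hMφ' : 0 ≤ Mφ')
    (hφ : ∀ w, ‖φ w‖ ≤ Mφ * ‖w‖) (hφ' : ∀ X, ‖φ.symm X‖ ≤ Mφ' * ‖X‖) (τ : 𝔸 →ₗ[ℂ] ℂ) {Cτ : ℝ} (hτ : ∀ X, ‖τ X‖ ≤ Cτ * ‖X‖) (hCτ : 0 ≤ Cτ) :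
    ∃ KG KA Kι ε₉ : ℝ, 0 < KG ∧ 0 < KA ∧ 0 < Kι ∧ 0 < ε₉ ∧ ∀ (U : Bond d (fineP L m) → 𝔸ˣ) {α : ℝ} (hα1 : α ≤ 1 / 64)
      (hU1 : ∀ (x : B7Prop1Explicit.Site d) (κ : Fin d), perCfg (fineP L m) U x κ ∈ U1 𝔸)
      (hreg : ∀ (y : TSite d m) (κ : Fin d) (r : Fin d → Fin L), ‖((Wcx L (perCfg (fineP L m) U) (cornerSite L y) κ (boxVec L r) : 𝔸ˣ) : 𝔸) - 1‖ ≤ α)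
      {ε : ℝ}, 0 ≤ ε → ε ≤ ε₉ → (∀ b, ‖(U b : 𝔸) - 1‖ ≤ ε) →
      (∀ (b : Bond d (fineP L m)) (v u : W), ⟪adTransportW φ U b v, u⟫_ℂ = ⟪v, adTransportW φ (fun b => (U b)⁻¹) b u⟫_ℂ) →
      ∀ (hpos : ∀ x : BondL2K ℂ d (fineP L m) c₀ W, x ≠ 0 →
          0 < RCLike.re ⟪x, laplaceAofBackground L m hL φ U hα1 hU1 hreg τ η (c₀ := c₀) (c₁ := c₁) a₀ x⟫_ℂ)
        (hQ : Function.Surjective (QtorusW L m hL φ U hα1 hU1 hreg (c₀ := c₀) (c₁ := c₁)))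
        (hpos₁ : ∀ x : BondL2K ℂ d (fineP L m) c₀ W, x ≠ 0 →
          0 < RCLike.re ⟪x, laplaceAofBackground L m hL φ (fun _ => 1) (show (0 : ℝ) ≤ 1 / 64 by norm_num) (hU1_one L m) (hreg_one L m) τ η
            (c₀ := c₀) (c₁ := c₁) a₀ x⟫_ℂ)
        (hQ₁ : Function.Surjective (QtorusW L m hL φ (fun _ => 1) (show (0 : ℝ) ≤ 1 / 64 by norm_num) (hU1_one L m) (hreg_one L m)
          (c₀ := c₀) (c₁ := c₁)))
        {W₁ : Space115 (L : ℝ) η lev₀ lev₁ (nabla115 η U) → NegSize (L : ℝ) η lev₀ 3 𝔸}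
        {W₂ : Space115 (L : ℝ) η lev₀ lev₁ (nabla115 η fun _ : Bond d (fineP L m) => (1 : 𝔸ˣ)) → NegSize (L : ℝ) η lev₀ 3 𝔸}
        {B₀ θ C₄ a₃ j a ε₄ B₀' θ' C₄' a₃' j' a' ε₄' δW ρ s : ℝ}
        (_R₁ : Regime (frakGLatticeCLM (L := (L : ℝ)) (η := η) (lev₀ := lev₀) φ hpos hQ lev₁ (nabla115 η U)) 0 W₁ B₀ θ C₄ a₃ j a ε₄)
        (_R₂ : Regime (frakGLatticeCLM (L := (L : ℝ)) (η := η) (lev₀ := lev₀) (Δ₁ := hessOp φ η (fun _ => 1) τ)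
          (Q := QtorusW L m hL φ (fun _ => 1) (show (0 : ℝ) ≤ 1 / 64 by norm_num) (hU1_one L m) (hreg_one L m) (c₀ := c₀) (c₁ := c₁))
          φ hpos₁ hQ₁ lev₁ (nabla115 η fun _ => 1)) 0 W₂ B₀' θ' C₄' a₃' j' a' ε₄')
        (_hj : 0 ≤ j) (_hj' : 0 ≤ j') (B : NegSize (L : ℝ) η levB 0 𝔸)
        (_hB : ‖H1LatticeCLM (L := (L : ℝ)) (η := η) (lev₀ := lev₀) (levB := levB) φ hpos hQ lev₁ (nabla115 η U) B‖ < a)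
        (_hB' : ‖H1LatticeCLM (L := (L : ℝ)) (η := η) (lev₀ := lev₀) (levB := levB) (Δ₁ := hessOp φ η (fun _ => 1) τ)
          (Q := QtorusW L m hL φ (fun _ => 1) (show (0 : ℝ) ≤ 1 / 64 by norm_num) (hU1_one L m) (hreg_one L m) (c₀ := c₀) (c₁ := c₁))
          φ hpos₁ hQ₁ lev₁ (nabla115 η fun _ => 1) B‖ < a')
        (_hδW : ∀ P : Space115 (L : ℝ) η lev₀ lev₁ (nabla115 η U), ‖P‖ < ε₄ + a →
          ‖W₁ P - W₂ (LinearMap.toContinuousLinearMap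
            ((jetLinearEquiv (L : ℝ) η lev₀ lev₁ (nabla115 η (fun _ : Bond d (fineP L m) => (1 : 𝔸ˣ)))).symm.toLinearMap ∘ₗ
              (jetLinearEquiv (L : ℝ) η lev₀ lev₁ (nabla115 η U)).toLinearMap) P)‖ ≤ δW)
        (_hρ₁ : (1 + Kι * ε) * (ε₄ + a) ≤ ρ) (_hρ₂ : ε₄' + a' ≤ ρ) (_hs : 0 < s) (_hdom : 2 * (ρ + s) ≤ a₃')
        (_hκ : θ' + 4 * B₀' * C₄' * (ρ + s) < 1)
        {b C₂c c₄ aC εC b' C₂c' c₄' aC' εC' δC ρC sC : ℝ}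
        (_RC₁ : Regime (H1LatticeCLM (L := (L : ℝ)) (η := η) (lev₀ := lev₀) (levB := levB) φ hpos hQ lev₁ (nabla115 η U)) 0
          (Cc L m η U lev₀ lev₁ (nabla115 η U) levB) b 0 C₂c c₄ 0 aC εC)
        (_RC₂ : Regime (H1LatticeCLM (L := (L : ℝ)) (η := η) (lev₀ := lev₀) (levB := levB) (Δ₁ := hessOp φ η (fun _ => 1) τ)
          (Q := QtorusW L m hL φ (fun _ => 1) (show (0 : ℝ) ≤ 1 / 64 by norm_num) (hU1_one L m) (hreg_one L m) (c₀ := c₀) (c₁ := c₁))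
          φ hpos₁ hQ₁ lev₁ (nabla115 η fun _ => 1)) 0
          (Cc L m η (fun _ : Bond d (fineP L m) => (1 : 𝔸ˣ)) lev₀ lev₁ (nabla115 η fun _ => 1) levB) b' 0 C₂c' c₄' 0 aC' εC')
        (_hcap : ε₄ + a ≤ aC) (_hcap' : ε₄' + a' ≤ aC')
        (_hδC : ∀ P : Space115 (L : ℝ) η lev₀ lev₁ (nabla115 η U), ‖P‖ < εC + aC →
          ‖Cc L m η U lev₀ lev₁ (nabla115 η U) levB P - Cc L m η (fun _ : Bond d (fineP L m) => (1 : 𝔸ˣ)) lev₀ lev₁ (nabla115 η fun _ => 1) levB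
            (LinearMap.toContinuousLinearMap
              ((jetLinearEquiv (L : ℝ) η lev₀ lev₁ (nabla115 η (fun _ : Bond d (fineP L m) => (1 : 𝔸ˣ)))).symm.toLinearMap ∘ₗ
                (jetLinearEquiv (L : ℝ) η lev₀ lev₁ (nabla115 η U)).toLinearMap) P)‖ ≤ δC)
        (_hρC₁ : (1 + Kι * ε) * (εC + aC) ≤ ρC) (_hρC₂ : εC' + aC' ≤ ρC) (_hsC : 0 < sC) (_hdomC : 2 * (ρC + sC) ≤ c₄')
        (_hκC : 4 * b' * C₂c' * (ρC + sC) < 1),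
      ‖LinearMap.toContinuousLinearMap
            ((jetLinearEquiv (L : ℝ) η lev₀ lev₁ (nabla115 η (fun _ : Bond d (fineP L m) => (1 : 𝔸ˣ)))).symm.toLinearMap ∘ₗ
              (jetLinearEquiv (L : ℝ) η lev₀ lev₁ (nabla115 η U)).toLinearMap)
          (chartHB (frakGLatticeCLM (L := (L : ℝ)) (η := η) (lev₀ := lev₀) φ hpos hQ lev₁ (nabla115 η U)) 0 W₁ 0
            (fun A' => A' + solA (H1LatticeCLM (L := (L : ℝ)) (η := η) (lev₀ := lev₀) (levB := levB) φ hpos hQ lev₁ (nabla115 η U)) 0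
              (Cc L m η U lev₀ lev₁ (nabla115 η U) levB) 0 εC A') ε₄
            (H1LatticeCLM (L := (L : ℝ)) (η := η) (lev₀ := lev₀) (levB := levB) φ hpos hQ lev₁ (nabla115 η U)) B) -
        chartHB (frakGLatticeCLM (L := (L : ℝ)) (η := η) (lev₀ := lev₀) (Δ₁ := hessOp φ η (fun _ => 1) τ)
              (Q := QtorusW L m hL φ (fun _ => 1) (show (0 : ℝ) ≤ 1 / 64 by norm_num) (hU1_one L m) (hreg_one L m) (c₀ := c₀) (c₁ := c₁))
              φ hpos₁ hQ₁ lev₁ (nabla115 η fun _ => 1)) 0 W₂ 0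
          (fun A' => A' + solA (H1LatticeCLM (L := (L : ℝ)) (η := η) (lev₀ := lev₀) (levB := levB) (Δ₁ := hessOp φ η (fun _ => 1) τ)
              (Q := QtorusW L m hL φ (fun _ => 1) (show (0 : ℝ) ≤ 1 / 64 by norm_num) (hU1_one L m) (hreg_one L m) (c₀ := c₀) (c₁ := c₁))
              φ hpos₁ hQ₁ lev₁ (nabla115 η fun _ => 1)) 0
            (Cc L m η (fun _ : Bond d (fineP L m) => (1 : 𝔸ˣ)) lev₀ lev₁ (nabla115 η fun _ => 1) levB) 0 εC' A') ε₄'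
          (H1LatticeCLM (L := (L : ℝ)) (η := η) (lev₀ := lev₀) (levB := levB) (Δ₁ := hessOp φ η (fun _ => 1) τ)
            (Q := QtorusW L m hL φ (fun _ => 1) (show (0 : ℝ) ≤ 1 / 64 by norm_num) (hU1_one L m) (hreg_one L m) (c₀ := c₀) (c₁ := c₁))
            φ hpos₁ hQ₁ lev₁ (nabla115 η fun _ => 1)) B‖ ≤
        1 / (1 - 4 * b' * C₂c' * (ρC + sC)) *
            ((KG * ε * (j + C₄ * (ε₄ + a) ^ 2) + 0 * (ε₄ + a) + B₀' * δW + KA * ε * ‖B‖) / (1 - (θ' + 4 * B₀' * C₄' * (ρ + s)))) +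
          (KA * ε * (C₂c * (εC + aC) ^ 2) + b' * δC) / (1 - 4 * b' * C₂c' * (ρC + sC)) := by
  obtain ⟨KG, KA, ε₉, hKG, hKA, hε₉, H⟩ :=
    exists_letter_defects_at_flat L m hL φ (c₀ := c₀) (c₁ := c₁) (η := η) lev₀ levB lev₁ ha₀ hMφ hMφ' hφ hφ' τ hτ hCτ
  obtain ⟨Kι, hKιdef⟩ : ∃ Kι : ℝ, Kι = (NegSup.wSup (levWeight (L : ℝ) η lev₁ 2) : ℝ) * (2 * ‖((η : ℂ))⁻¹‖) *
      NegSup.wInvSup (levWeight (L : ℝ) η lev₀ 1) + 1 := ⟨_, rfl⟩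
  have hKι : 0 < Kι := by rw [hKιdef]; positivity
  refine ⟨KG, KA, Kι, ε₉, hKG, hKA, hKι, hε₉, ?_⟩
  intro U α hα1 hU1 hreg ε hε hεε₉ hUε hRS hpos hQ hpos₁ hQ₁ W₁ W₂ B₀ θ C₄ a₃ j a ε₄ B₀' θ' C₄' a₃' j' a' ε₄' δW ρ s R₁ R₂ hj hj' B hB hB'
    hδW hρ₁ hρ₂ hs hdom hκ b C₂c c₄ aC εC b' C₂c' c₄' aC' εC' δC ρC sC RC₁ RC₂ hcap hcap' hδC hρC₁ hρC₂ hsC hdomC hκC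
  obtain ⟨HG, HA⟩ := H U hα1 hU1 hreg hε hεε₉ hUε hRS hpos hQ hpos₁ hQ₁
  have hUb : ∀ b : Bond d (fineP L m), U b ∈ U1 𝔸 := fun b => by
    obtain ⟨y, κ⟩ := b
    have h := hU1 (liftSite y) κ
    rwa [B9Eq315QTorus.perCfg_apply, perSite_liftSite] at h
  have hι : ∀ f : Space115 (L : ℝ) η lev₀ lev₁ (nabla115 η U),
      ‖LinearMap.toContinuousLinearMap
          ((jetLinearEquiv (L : ℝ) η lev₀ lev₁ (nabla115 η (fun _ : Bond d (fineP L m) => (1 : 𝔸ˣ)))).symm.toLinearMap ∘ₗ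
            (jetLinearEquiv (L : ℝ) η lev₀ lev₁ (nabla115 η U)).toLinearMap) f‖ ≤ (1 + Kι * ε) * ‖f‖ := fun f => by
    refine (norm_jetId_nabla_le L m (η := η) (lev₀ := lev₀) lev₁ U hUb hε hUε f).trans (mul_le_mul_of_nonneg_right ?_ (norm_nonneg f))
    rw [hKιdef]
    have h0 : 0 ≤ (NegSup.wSup (levWeight (L : ℝ) η lev₁ 2) : ℝ) * (2 * ‖((η : ℂ))⁻¹‖ * ε) * NegSup.wInvSup (levWeight (L : ℝ) η lev₀ 1) := by
      positivity
    nlinarith [h0, hε]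
  have hKAε : 0 ≤ KA * ε := by positivity
  have h := norm_map_chartHB_sectC_sub_le R₁ R₂ RC₁ RC₂ hj hj' hB hB' hcap hcap' (by positivity) hι (by positivity) HG hδW hKAε HA hδC
    hρ₁ hρ₂ hs hdom hκ hρC₁ hρC₂ hsC hdomC hκC
  exact h

end Literature.MathematicalPhysics.QuantumFieldTheory.Balaban1983to89.B11Eq174ChartContinuityAtFlat

end
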